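import Summits.AtomisticToContinuum.Crystallization.Cruxes.TruncatedCensusGap.IdeatorThreeSketch
import Summits.AtomisticToContinuum.Crystallization.Theorems.TruncatedCensusGap.Negative.KappaZeroHalf

/-!
# crux-triage r1, triager 1 — positive first lemmas of the ideator-3 cards (candidate proofs, NOT
mine to land; attached as item evidence for a prover)

* `slackGivesPairLocalBound_holds` — card gap-distance-slack's first lemma `SlackGivesPairLocalBound`
  (linearity of `interactionEnergy` in the potential + the landed finite-range trial-state bound
  `iInf_energyPerParticle_le_div` for `V_χ − P`).  Confirms the card's "provable now".
* `pointwisePricedLocalisationGivesGap_holds` — card sharp-m-potential-compactness's companion shape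
  statement (pure bookkeeping, as the card says).
-/

noncomputable section

namespace Summit.AtomisticToContinuum.Crystallization.Cruxes.TruncatedCensusGap.TriageR1K1

open Literature.MathematicalPhysics.StatisticalMechanics Literature.Geometry.DiscreteGeometry
open Summit.AtomisticToContinuum.Crystallization.Cruxes.TruncatedCensusGap.Sketch
open Summit.AtomisticToContinuum.Crystallization.Theorems (iInf_energyPerParticle_le_div)
open Summit.AtomisticToContinuum.Crystallization.Theses.PricedLinkCensus (TruncatedCensusGap)

/-- `interactionEnergy` is additive in the potential. -/
theorem interactionEnergy_add (V W : ℝ → ℝ) {d N : ℕ} (x : Fin N → EuclideanSpace ℝ (Fin d)) :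
    interactionEnergy (fun r => V r + W r) x = interactionEnergy V x + interactionEnergy W x := by
  unfold interactionEnergy
  rw [← Finset.sum_add_distrib]
  refine Finset.sum_congr rfl fun i _ => ?_
  rw [← Finset.sum_add_distrib]

/-- Card gap-distance-slack, first lemma: slack in the potential gives a pair-local lower bound. -/
theorem slackGivesPairLocalBound_holds : SlackGivesPairLocalBound := by
  intro P _hP0 hP2 hB hinf N y hy
  have hsplit : interactionEnergy Vχ y =
      interactionEnergy (fun r => Vχ r - P r) y + interactionEnergy P y := by
    rw [← interactionEnergy_add]
    simp only [sub_add_cancel]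
  rcases Nat.eq_zero_or_pos N with hN0 | hN
  · subst hN0
    simp [interactionEnergy]
  · have hV : ∀ r, 2 ≤ r → (fun r => Vχ r - P r) r = 0 := by
      intro r hr
      have hmax : max 0 (4 - 2 * r) = 0 := max_eq_left (by linarith)
      simp [Vχ, hmax, hP2 r hr]
    have h := iInf_energyPerParticle_le_div hV hB hy hN
    rw [hinf, le_div_iff₀ (by exact_mod_cast hN)] at h
    linarith

/-- Card sharp-m-potential-compactness, companion shape statement: a priced non-negative site
functional summing to the excess gives the crux (bookkeeping). -/
theorem pointwisePricedLocalisationGivesGap_holds : PointwisePricedLocalisationGivesGap := by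
  intro h κ₀ hκ hsum hnn hch
  refine ⟨κ₀, hκ, fun N y hy => ?_⟩
  classical
  change (N : ℝ) * eStar + κ₀ * (Nat.card {i : Fin N // ¬ IsChargeFree (1 / 100 : ℝ) y i} : ℝ) ≤
    interactionEnergy Vχ y
  have hcard : Nat.card {i : Fin N // ¬ IsChargeFree (1 / 100 : ℝ) y i} =
      (Finset.univ.filter fun i : Fin N => ¬ IsChargeFree (1 / 100 : ℝ) y i).card := by
    rw [Nat.card_eq_fintype_card, Fintype.card_subtype]
  have h1 : ((Finset.univ.filter fun i : Fin N => ¬ IsChargeFree (1 / 100 : ℝ) y i).card : ℝ) * κ₀ ≤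
      ∑ i ∈ Finset.univ.filter (fun i : Fin N => ¬ IsChargeFree (1 / 100 : ℝ) y i), h N y i := by
    have := Finset.card_nsmul_le_sum (Finset.univ.filter fun i : Fin N => ¬ IsChargeFree (1 / 100 : ℝ) y i)
      (fun i => h N y i) κ₀ (fun i hi => hch N y i hy (Finset.mem_filter.1 hi).2)
    simpa [nsmul_eq_mul] using this
  have h2 : ∑ i ∈ Finset.univ.filter (fun i : Fin N => ¬ IsChargeFree (1 / 100 : ℝ) y i), h N y i ≤
      ∑ i, h N y i :=
    Finset.sum_le_univ_sum_of_nonneg fun i => hnn N y i hy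
  have h3 := hsum N y hy
  rw [hcard]
  nlinarith [h1, h2, h3, mul_comm (κ₀) ((Finset.univ.filter fun i : Fin N => ¬ IsChargeFree (1 / 100 : ℝ) y i).card : ℝ)]

end Summit.AtomisticToContinuum.Crystallization.Cruxes.TruncatedCensusGap.TriageR1K1

end
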